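import Summits.AtomisticToContinuum.Crystallization.Theorems.HullExactificationCascadeHullGoodEverywhereDefs
import Summits.AtomisticToContinuum.Crystallization.Theorems.HullExactificationCascadeZeroDefectDensityAsmFrame
import Mathlib.Data.Set.Card
import HarnessLib

/-!
# Assembly toolkit II (crux `ZeroDefectDensity`, line `birth`, stub `stub_assembly`): the soft shell of a
# two-shell softly twelve-kissed point, and the reduction of `SiteGood` to a frame approximation

Context (scale `1`, tolerance `η = 1/4000`, gap `131/100`): `u ∈ S` and every point of `S` within
`13/5` of `u` is softly twelve-kissed.  Then

* `softKissed_self`, `one_sub_le_dist`, `dichotomy` — bookkeeping at `u`;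
* `sInf_dist_mem_Icc` — the crux's local scale `d = dist(u, S ∖ {u})` lies in `[1 - η, 1 + η]`;
* `strictShell_eq_softShell` — the crux's strict `13/10 · d` shell IS the soft shell
  `{w ∈ S | w ≠ u ∧ dist u w ≤ 1 + 1/400}` (the domain of the `LocalHalesKernel` isomorphism);
* `siteGood_of_frameApprox` — **reduction**: if a linear isometry `A` puts every recentred soft-shell
  point within `49/1000` of the image of its pattern label, then `SiteGood S u` (the `d⁻¹` rescaling costs
  at most `|d⁻¹ - 1| ≤ η/(1-η)` per unit vector).

All elementary; no facts are cited. [folklore]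
-/

noncomputable section

namespace Summit.AtomisticToContinuum.Crystallization.Theorems.ZeroDefectDensityBirth

open Real RealInnerProductSpace Literature.Geometry.DiscreteGeometry
open Summit.AtomisticToContinuum.Crystallization.Theorems

/-! ### Bookkeeping at the centre -/

section Shell

variable {S : Set (EuclideanSpace ℝ (Fin 3))} {u : EuclideanSpace ℝ (Fin 3)}

/-- The two-shell soft-kissing hypothesis of the line at scale `1` (abbreviation-free, as inlined in the
registered stubs). [folklore] -/
theorem softKissed_self (hu : u ∈ S)
    (hS : ∀ v ∈ S, dist u v ≤ 13 / 5 → ((∀ w ∈ S, w ≠ v → 1 - 1 / 4000 ≤ dist v w ∧ (dist v w ≤ 1 + 1 / 4000 ∨ 131 / 100 ≤ dist v w)) ∧ {w ∈ S | w ≠ v ∧ dist v w ≤ 1 + 1 / 4000}.ncard = 12)) :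
    (∀ w ∈ S, w ≠ u → 1 - 1 / 4000 ≤ dist u w ∧ (dist u w ≤ 1 + 1 / 4000 ∨ 131 / 100 ≤ dist u w)) ∧
      {w ∈ S | w ≠ u ∧ dist u w ≤ 1 + 1 / 4000}.ncard = 12 :=
  hS u hu (by rw [dist_self]; norm_num)

/-- The soft shell of `u` is nonempty (it has twelve points). [folklore] -/
theorem exists_softContact (hu : u ∈ S)
    (hS : ∀ v ∈ S, dist u v ≤ 13 / 5 → ((∀ w ∈ S, w ≠ v → 1 - 1 / 4000 ≤ dist v w ∧ (dist v w ≤ 1 + 1 / 4000 ∨ 131 / 100 ≤ dist v w)) ∧ {w ∈ S | w ≠ v ∧ dist v w ≤ 1 + 1 / 4000}.ncard = 12)) :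
    ∃ w ∈ S, w ≠ u ∧ dist u w ≤ 1 + 1 / 4000 := by
  have h12 := (softKissed_self hu hS).2
  have hne : {w ∈ S | w ≠ u ∧ dist u w ≤ 1 + 1 / 4000}.Nonempty := by
    apply Set.nonempty_of_ncard_ne_zero
    rw [h12]; norm_num
  obtain ⟨w, hw, hwu, hd⟩ := hne
  exact ⟨w, hw, hwu, hd⟩

/-- **The local scale.** `d = sInf {dist z u : z ∈ S ∖ {u}}` lies in `[1 - η, 1 + η]`. [folklore] -/
theorem sInf_dist_mem_Icc (hu : u ∈ S)
    (hS : ∀ v ∈ S, dist u v ≤ 13 / 5 → ((∀ w ∈ S, w ≠ v → 1 - 1 / 4000 ≤ dist v w ∧ (dist v w ≤ 1 + 1 / 4000 ∨ 131 / 100 ≤ dist v w)) ∧ {w ∈ S | w ≠ v ∧ dist v w ≤ 1 + 1 / 4000}.ncard = 12)) :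
    1 - 1 / 4000 ≤ sInf ((fun z => dist z u) '' (S \ {u})) ∧
      sInf ((fun z => dist z u) '' (S \ {u})) ≤ 1 + 1 / 4000 := by
  obtain ⟨w, hw, hwu, hd⟩ := exists_softContact hu hS
  have hsep := (softKissed_self hu hS).1
  have hwu' : w ∉ ({u} : Set (EuclideanSpace ℝ (Fin 3))) := fun h => hwu (Set.mem_singleton_iff.1 h)
  have hne : ((fun z => dist z u) '' (S \ {u})).Nonempty := ⟨dist w u, w, ⟨hw, hwu'⟩, rfl⟩
  have hbdd : BddBelow ((fun z => dist z u) '' (S \ {u})) := ⟨0, by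
    rintro _ ⟨z, -, rfl⟩; exact dist_nonneg⟩
  constructor
  · apply le_csInf hne
    rintro _ ⟨z, ⟨hz, hzu⟩, rfl⟩
    have hzu' : z ≠ u := fun h => hzu (Set.mem_singleton_iff.2 h)
    show 1 - 1 / 4000 ≤ dist z u
    rw [dist_comm]
    exact (hsep z hz hzu').1
  · calc sInf ((fun z => dist z u) '' (S \ {u})) ≤ dist w u := csInf_le hbdd ⟨w, ⟨hw, hwu'⟩, rfl⟩
      _ ≤ 1 + 1 / 4000 := by rw [dist_comm]; exact hd

/-- **The strict `13/10·d` shell of the crux is the soft shell.** [folklore] -/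
theorem strictShell_eq_softShell (hu : u ∈ S)
    (hS : ∀ v ∈ S, dist u v ≤ 13 / 5 → ((∀ w ∈ S, w ≠ v → 1 - 1 / 4000 ≤ dist v w ∧ (dist v w ≤ 1 + 1 / 4000 ∨ 131 / 100 ≤ dist v w)) ∧ {w ∈ S | w ≠ v ∧ dist v w ≤ 1 + 1 / 4000}.ncard = 12)) :
    {z : EuclideanSpace ℝ (Fin 3) | z ∈ S ∧ z ≠ u ∧
        dist z u < 13 / 10 * sInf ((fun z => dist z u) '' (S \ {u}))} =
      {w : EuclideanSpace ℝ (Fin 3) | w ∈ S ∧ w ≠ u ∧ dist u w ≤ 1 + 1 / 400} := by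
  obtain ⟨hlo, hhi⟩ := sInf_dist_mem_Icc hu hS
  have hsep := (softKissed_self hu hS).1
  ext z
  simp only [Set.mem_setOf_eq]
  constructor
  · rintro ⟨hz, hzu, hdz⟩
    refine ⟨hz, hzu, ?_⟩
    rcases (hsep z hz hzu).2 with h | h
    · linarith
    · exfalso
      rw [dist_comm] at hdz
      linarith
  · rintro ⟨hz, hzu, hdz⟩
    refine ⟨hz, hzu, ?_⟩
    rcases (hsep z hz hzu).2 with h | h
    · rw [dist_comm]; linarith
    · linarith

end Shell

/-! ### Reduction of `SiteGood` to a frame approximation -/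

/-- Transport of a `1/20`-matching along an equality of index sets: generic helper. [folklore] -/
theorem match_transport {T T' : Set (EuclideanSpace ℝ (Fin 3))} (hTT' : T = T')
    (P : Finset (EuclideanSpace ℝ (Fin 3))) (e : ↥T' ≃ ↥P) (f : EuclideanSpace ℝ (Fin 3) → EuclideanSpace ℝ (Fin 3))
    (g : EuclideanSpace ℝ (Fin 3) → EuclideanSpace ℝ (Fin 3)) (c : ℝ)
    (h : ∀ t : ↥T', dist (f t.1) (g (e t).1) ≤ c) :
    ∃ e' : ↥T ≃ ↥P, ∀ t : ↥T, dist (f t.1) (g (e' t).1) ≤ c := by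
  subst hTT'
  exact ⟨e, h⟩

/-- **Reduction.**  Two-shell soft kissing at `u` and a linear isometry `A` putting every recentred
soft-shell point within `49/1000` of its pattern label (through a bijection `e` with the fcc or the hcp
kissing pattern) give `SiteGood S u`: the crux's shell is the soft shell, its scale `d` is within `η` of
`1`, and `dist (d⁻¹ • x) y ≤ d⁻¹ · 49/1000 + |d⁻¹ - 1| < 1/20`. [folklore] -/
theorem siteGood_of_frameApprox {S : Set (EuclideanSpace ℝ (Fin 3))} {u : EuclideanSpace ℝ (Fin 3)}
    (hu : u ∈ S)
    (hS : ∀ v ∈ S, dist u v ≤ 13 / 5 → ((∀ w ∈ S, w ≠ v → 1 - 1 / 4000 ≤ dist v w ∧ (dist v w ≤ 1 + 1 / 4000 ∨ 131 / 100 ≤ dist v w)) ∧ {w ∈ S | w ≠ v ∧ dist v w ≤ 1 + 1 / 4000}.ncard = 12))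
    {P : Finset (EuclideanSpace ℝ (Fin 3))} (hP : P = fccKissingPattern ∨ P = hcpKissingPattern)
    (e : {w : EuclideanSpace ℝ (Fin 3) // w ∈ S ∧ w ≠ u ∧ dist u w ≤ 1 + 1 / 400} ≃ ↥P)
    (A : EuclideanSpace ℝ (Fin 3) →ₗᵢ[ℝ] EuclideanSpace ℝ (Fin 3))
    (happrox : ∀ t : {w : EuclideanSpace ℝ (Fin 3) // w ∈ S ∧ w ≠ u ∧ dist u w ≤ 1 + 1 / 400},
      ‖(t.1 - u) - A (e t).1‖ ≤ 49 / 1000) :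
    SiteGood S u := by
  obtain ⟨hlo, hhi⟩ := sInf_dist_mem_Icc hu hS
  set d : ℝ := sInf ((fun z => dist z u) '' (S \ {u})) with hd
  have hdpos : 0 < d := by linarith
  have hshell := strictShell_eq_softShell hu hS
  -- the bound after rescaling
  have hbound : ∀ t : {w : EuclideanSpace ℝ (Fin 3) // w ∈ S ∧ w ≠ u ∧ dist u w ≤ 1 + 1 / 400},
      dist (d⁻¹ • (t.1 - u)) (A (e t).1) ≤ 1 / 20 := by
    intro t
    have hn : ‖A (e t).1‖ = 1 := by
      rw [LinearIsometry.norm_map]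
      rcases hP with rfl | rfl
      · exact norm_eq_one_of_mem_fccKissingPattern (e t).2
      · exact norm_eq_one_of_mem_hcpKissingPattern (e t).2
    have h1 := dist_inv_smul_le (y := A (e t).1) hdpos (happrox t)
    rw [hn, mul_one] at h1
    have hdinv_le : d⁻¹ ≤ (1 - 1 / 4000)⁻¹ := by
      rw [inv_le_inv₀ hdpos (by norm_num)]; exact hlo
    have hdinv_ge : (1 + 1 / 4000)⁻¹ ≤ d⁻¹ := by
      rw [inv_le_inv₀ (by norm_num) hdpos]; exact hhi
    have habs : |d⁻¹ - 1| ≤ 1 / 3999 := by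
      rw [abs_sub_le_iff]
      constructor
      · calc d⁻¹ - 1 ≤ (1 - 1 / 4000)⁻¹ - 1 := by linarith
          _ ≤ 1 / 3999 := by norm_num
      · calc 1 - d⁻¹ ≤ 1 - (1 + 1 / 4000)⁻¹ := by linarith
          _ ≤ 1 / 3999 := by norm_num
    calc dist (d⁻¹ • (t.1 - u)) (A (e t).1) ≤ d⁻¹ * (49 / 1000) + |d⁻¹ - 1| := h1
      _ ≤ (1 - 1 / 4000)⁻¹ * (49 / 1000) + 1 / 3999 := by gcongr
      _ ≤ 1 / 20 := by norm_num
  -- assemble `SiteGood`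
  show ∃ A' : EuclideanSpace ℝ (Fin 3) →ₗᵢ[ℝ] EuclideanSpace ℝ (Fin 3), _
  refine ⟨A, ?_⟩
  rcases hP with rfl | rfl
  · left
    exact match_transport hshell fccKissingPattern e (fun x => d⁻¹ • (x - u)) (fun y => A y) (1 / 20) hbound
  · right
    exact match_transport hshell hcpKissingPattern e (fun x => d⁻¹ • (x - u)) (fun y => A y) (1 / 20) hbound

/-- **Reduction**, registered sub-goal form of `siteGood_of_frameApprox`. [folklore] -/
theorem siteGood_of_frameApprox' : ∀ (S : Set (EuclideanSpace ℝ (Fin 3))) (u : EuclideanSpace ℝ (Fin 3)), u ∈ S → (∀ v ∈ S, dist u v ≤ 13 / 5 → ((∀ w ∈ S, w ≠ v → 1 - 1 / 4000 ≤ dist v w ∧ (dist v w ≤ 1 + 1 / 4000 ∨ 131 / 100 ≤ dist v w)) ∧ {w ∈ S | w ≠ v ∧ dist v w ≤ 1 + 1 / 4000}.ncard = 12)) → ∀ (P : Finset (EuclideanSpace ℝ (Fin 3))), (P = Literature.Geometry.DiscreteGeometry.fccKissingPattern ∨ P = Literature.Geometry.DiscreteGeometry.hcpKissingPattern) → ∀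 (e : {w : EuclideanSpace ℝ (Fin 3) // w ∈ S ∧ w ≠ u ∧ dist u w ≤ 1 + 1 / 400} ≃ ↥P) (A : EuclideanSpace ℝ (Fin 3) →ₗᵢ[ℝ] EuclideanSpace ℝ (Fin 3)), (∀ t : {w : EuclideanSpace ℝ (Fin 3) // w ∈ S ∧ w ≠ u ∧ dist u w ≤ 1 + 1 / 400}, ‖(t.1 - u) - A (e t).1‖ ≤ 49 / 1000) → Summit.AtomisticToContinuum.Crystallization.Theorems.SiteGood S u :=
  fun _ _ hu hS _ hP e A h => siteGood_of_frameApprox hu hS hP e A h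

end Summit.AtomisticToContinuum.Crystallization.Theorems.ZeroDefectDensityBirth

end
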